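import Summits.ValiantsHypothesis.ValiantsHypothesis.Theorems.LacunarySymmetroidMatrixDescartesCensusAtomM8K4TW80
import Summits.ValiantsHypothesis.ValiantsHypothesis.Theorems.LacunarySymmetroidMatrixDescartesCensusAtomM8K5GF95
import Summits.ValiantsHypothesis.ValiantsHypothesis.Theorems.LacunarySymmetroidMatrixDescartesCensusAtomM8K3LT44
import Summits.ValiantsHypothesis.ValiantsHypothesis.Theorems.LacunarySymmetroidMatrixDescartesCensusAtomM8K4QF83
import Summits.ValiantsHypothesis.ValiantsHypothesis.Theorems.LacunarySymmetroidMatrixDescartesCensusAtomM8K4QF85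

/-!
# `MatrixDescartes` census — MIXED JUNCTION ROWS at `m = 8` from the atom blocks (block words, one line each)

HONEST FRAMING.  Experiment cell `val-V1-extremal`, width seat val-v1x-eng-8 g3 (`mixgen.py`).  Each theorem below is a census LOWER bound
`¬ PosRootLawAt 8 K (N − 1)` («some real symmetric `K`-letter `8 × 8` lacunary pencil has `N` distinct positive determinant roots»)
obtained from kernel-certified ATOM BLOCKS of this cell (files `…CensusAtom*`: alternation certificate + Sylvester forms of the end letters,
all checked by the kernel) by the tree's JUNCTION LAW for matching junction inertia (`Chain.chain_append`, `…ChainInertia` /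
`…ChainBlocks`, seat val-sym-mdr-p1) — alternation counts ADD, letter counts add minus one per junction — plus trailing grafts
(`+8` per added letter, `Reflect.not_posRootLawAt_of_certificateT_add`).  `ʳ` = block reversed (`x ↦ 1/x`, `Reflect.block_reverse`),
`⁻` = all letters negated (`blockNeg`).  No explicit chained pencil is ever written: the kernel checks each atom once and the words here
are bookkeeping.  Rows: (8,11) ≥ 255 [M8K4TW80 ▹ M8K4TW80 ▹ M8K5GF95] (was 248).  CONSTRUCTION-FAMILY provenance (junctions of flags/caps/towers found by the cell's engine seats —
credits in the atom files).  Nothing here bears on the asymptotic crux `Theses.LacunarySymmetroid.MatrixDescartes`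
(stmt-ValiantsHypothesis-18050) nor on `VP ≠ VNP`; VP ≠ VNP is NOT proved.  Generated 2026-08-29T03:13Z.  [folklore]
-/

-- `Summit.ValiantsHypothesis.ValiantsHypothesis.…` repeats a component by the D-0017 layout
-- (single-conjunct summit), which the `dupNamespace` linter flags; the name is mandated.
set_option linter.dupNamespace false

namespace Summit.ValiantsHypothesis.ValiantsHypothesis.Theorems.LacunarySymmetroidMatrixDescartes.Census.Reflect.MixM8

open Summit.ValiantsHypothesis.ValiantsHypothesis.Theorems.MatrixDescartes.Negative (PosRootLawAt)
open Summit.ValiantsHypothesis.ValiantsHypothesis.Theorems.LacunarySymmetroidMatrixDescartes.Census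
open Summit.ValiantsHypothesis.ValiantsHypothesis.Theorems.LacunarySymmetroidMatrixDescartes.Census.Reflect

/-- **`ζ_sym(8,11) ≥ 255`** (`¬ PosRootLawAt 8 11 254`) — the block word `M8K4TW80 ▹ M8K4TW80 ▹ M8K5GF95` = `80 + 80 + 95` alternations on
`4 + 4 + 5 − 2` letters (junction law for matching junction inertia; kernel value before this file: 248). TOWER4-80 ▹ TOWER4-80 ▹ GAPFLAG95 (conjb-3 towers, val-v1x-eng-2 g0 gap-flag; all junction letters inertia (4,4)). [folklore] -/
theorem mix_8_11 : ¬ PosRootLawAt 8 11 254 := by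
  have h := Chain.not_posRootLawAt_of_certificateT (by norm_num)
      (Chain.chain_append (by norm_num) (Chain.chain_append (by norm_num) (Chain.chain_of_block Reflect.AtomM8K4TW80.block)
        Reflect.AtomM8K4TW80.block (Equiv.refl (Fin 8)) (by intro i; fin_cases i <;> norm_num))
        Reflect.AtomM8K5GF95.block (Equiv.refl (Fin 8)) (by intro i; fin_cases i <;> norm_num))
  norm_num at h
  exact h

/-! ### Rows appended 2026-08-29T04:19Z (val-v1x-eng-8 g3): (8,6) ≥ 127 [M8K3LT44 ▹ M8K4QF83] (was 124); (8,7) ≥ 166 [M8K4QF83ʳ ▹ M8K4QF83] (was 160); (8,8) ≥ 178 [M8K4QF83 ▹ M8K5GF95ʳ] (was 175); (8,9) ≥ 210 [M8K3LT44 ▹ M8K4QF83 ▹ M8K4QF83ʳ] (was 204); (8,10) ≥ 249 [M8K4QF83 ▹ M8K4QF83ʳ ▹ M8K4QF83] (was 240); (8,11) ≥ 261 [M8K4QF83 ▹ M8K4QF83ʳ ▹ M8K5GF95] (was 255); (8,12) ≥ 293 [M8K3LT44 ▹ M8K4QF83 ▹ M8K4QF83ʳ ▹ M8K4QF83] (was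 284); (8,13) ≥ 332 [M8K4QF83 ▹ M8K4QF83ʳ ▹ M8K4QF83 ▹ M8K4QF83ʳ] (was 320). -/

/-- **`ζ_sym(8,6) ≥ 127`** (`¬ PosRootLawAt 8 6 126`) — the block word `M8K3LT44 ▹ M8K4QF83` = `44 + 83` alternations on
`3 + 4 − 1` letters (junction law for matching junction inertia; kernel value before this file: 124). THE (8,6) JUNCTION asked for by val-v1x-eng-7 g3 (03:38Z) and the lead: conjb-3 C3-LAGTOWER44 ▹ eng-7 g3 QF83 (quadric-seeded flag on the mirrored Lagrange tower, seeder val-v1x-eng-2 g2) on the shared inertia-(4,4) letter; B(8,6) = 124 ⇒ 127 = B+3 (the explicit junction pencil E10G3-CHAIN127 is being built by val-v1x-eng-10 g3 for the two-code row). [folklore] -/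
theorem mix_8_6 : ¬ PosRootLawAt 8 6 126 := by
  have h := Chain.not_posRootLawAt_of_certificateT (by norm_num)
      (Chain.chain_append (by norm_num) (Chain.chain_of_block Reflect.AtomM8K3LT44.block)
        Reflect.AtomM8K4QF83.block (Equiv.refl (Fin 8)) (by intro i; fin_cases i <;> norm_num))
  norm_num at h
  exact h

/-- **`ζ_sym(8,7) ≥ 166`** (`¬ PosRootLawAt 8 7 165`) — the block word `M8K4QF83ʳ ▹ M8K4QF83` = `83 + 83` alternations on
`4 + 4 − 1` letters (junction law for matching junction inertia; kernel value before this file: 160). self-junction of QF83 on its (4,4) tower end. [folklore] -/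
theorem mix_8_7 : ¬ PosRootLawAt 8 7 165 := by
  have h := Chain.not_posRootLawAt_of_certificateT (by norm_num)
      (Chain.chain_append (by norm_num) (Chain.chain_of_block (block_reverse Reflect.AtomM8K4QF83.block))
        Reflect.AtomM8K4QF83.block (Equiv.refl (Fin 8)) (by intro i; fin_cases i <;> norm_num))
  norm_num at h
  exact h

/-- **`ζ_sym(8,8) ≥ 178`** (`¬ PosRootLawAt 8 8 177`) — the block word `M8K4QF83 ▹ M8K5GF95ʳ` = `83 + 95` alternations on
`4 + 5 − 1` letters (junction law for matching junction inertia; kernel value before this file: 175). QF83 ▹ GAPFLAG95 reversed, glued on the two inertia-(3,5) flag letters. [folklore] -/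
theorem mix_8_8 : ¬ PosRootLawAt 8 8 177 := by
  have h := Chain.not_posRootLawAt_of_certificateT (by norm_num)
      (Chain.chain_append (by norm_num) (Chain.chain_of_block Reflect.AtomM8K4QF83.block)
        (block_reverse Reflect.AtomM8K5GF95.block) (Equiv.refl (Fin 8)) (by intro i; fin_cases i <;> norm_num))
  norm_num at h
  exact h

/-- **`ζ_sym(8,9) ≥ 210`** (`¬ PosRootLawAt 8 9 209`) — the block word `M8K3LT44 ▹ M8K4QF83 ▹ M8K4QF83ʳ` = `44 + 83 + 83` alternations on
`3 + 4 + 4 − 2` letters (junction law for matching junction inertia; kernel value before this file: 204). [folklore] -/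
theorem mix_8_9 : ¬ PosRootLawAt 8 9 209 := by
  have h := Chain.not_posRootLawAt_of_certificateT (by norm_num)
      (Chain.chain_append (by norm_num) (Chain.chain_append (by norm_num) (Chain.chain_of_block Reflect.AtomM8K3LT44.block)
        Reflect.AtomM8K4QF83.block (Equiv.refl (Fin 8)) (by intro i; fin_cases i <;> norm_num))
        (block_reverse Reflect.AtomM8K4QF83.block) (Equiv.refl (Fin 8)) (by intro i; fin_cases i <;> norm_num))
  norm_num at h
  exact h

/-- **`ζ_sym(8,10) ≥ 249`** (`¬ PosRootLawAt 8 10 248`) — the block word `M8K4QF83 ▹ M8K4QF83ʳ ▹ M8K4QF83` = `83 + 83 + 83` alternations on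
`4 + 4 + 4 − 2` letters (junction law for matching junction inertia; kernel value before this file: 240). [folklore] -/
theorem mix_8_10 : ¬ PosRootLawAt 8 10 248 := by
  have h := Chain.not_posRootLawAt_of_certificateT (by norm_num)
      (Chain.chain_append (by norm_num) (Chain.chain_append (by norm_num) (Chain.chain_of_block Reflect.AtomM8K4QF83.block)
        (block_reverse Reflect.AtomM8K4QF83.block) (Equiv.refl (Fin 8)) (by intro i; fin_cases i <;> norm_num))
        Reflect.AtomM8K4QF83.block (Equiv.refl (Fin 8)) (by intro i; fin_cases i <;> norm_num))
  norm_num at h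
  exact h

/-- **`ζ_sym(8,11) ≥ 261`** (`¬ PosRootLawAt 8 11 260`) — the block word `M8K4QF83 ▹ M8K4QF83ʳ ▹ M8K5GF95` = `83 + 83 + 95` alternations on
`4 + 4 + 5 − 2` letters (junction law for matching junction inertia; kernel value before this file: 255). supersedes `mix_8_11` (255) above. [folklore] -/
theorem mix_8_11_qf83 : ¬ PosRootLawAt 8 11 260 := by
  have h := Chain.not_posRootLawAt_of_certificateT (by norm_num)
      (Chain.chain_append (by norm_num) (Chain.chain_append (by norm_num) (Chain.chain_of_block Reflect.AtomM8K4QF83.block)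
        (block_reverse Reflect.AtomM8K4QF83.block) (Equiv.refl (Fin 8)) (by intro i; fin_cases i <;> norm_num))
        Reflect.AtomM8K5GF95.block (Equiv.refl (Fin 8)) (by intro i; fin_cases i <;> norm_num))
  norm_num at h
  exact h

/-- **`ζ_sym(8,12) ≥ 293`** (`¬ PosRootLawAt 8 12 292`) — the block word `M8K3LT44 ▹ M8K4QF83 ▹ M8K4QF83ʳ ▹ M8K4QF83` = `44 + 83 + 83 + 83` alternations on
`3 + 4 + 4 + 4 − 3` letters (junction law for matching junction inertia; kernel value before this file: 284). [folklore] -/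
theorem mix_8_12 : ¬ PosRootLawAt 8 12 292 := by
  have h := Chain.not_posRootLawAt_of_certificateT (by norm_num)
      (Chain.chain_append (by norm_num) (Chain.chain_append (by norm_num) (Chain.chain_append (by norm_num) (Chain.chain_of_block Reflect.AtomM8K3LT44.block)
        Reflect.AtomM8K4QF83.block (Equiv.refl (Fin 8)) (by intro i; fin_cases i <;> norm_num))
        (block_reverse Reflect.AtomM8K4QF83.block) (Equiv.refl (Fin 8)) (by intro i; fin_cases i <;> norm_num))
        Reflect.AtomM8K4QF83.block (Equiv.refl (Fin 8)) (by intro i; fin_cases i <;> norm_num))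
  norm_num at h
  exact h

/-- **`ζ_sym(8,13) ≥ 332`** (`¬ PosRootLawAt 8 13 331`) — the block word `M8K4QF83 ▹ M8K4QF83ʳ ▹ M8K4QF83 ▹ M8K4QF83ʳ` = `83 + 83 + 83 + 83` alternations on
`4 + 4 + 4 + 4 − 3` letters (junction law for matching junction inertia; kernel value before this file: 320). [folklore] -/
theorem mix_8_13 : ¬ PosRootLawAt 8 13 331 := by
  have h := Chain.not_posRootLawAt_of_certificateT (by norm_num)
      (Chain.chain_append (by norm_num) (Chain.chain_append (by norm_num) (Chain.chain_append (by norm_num) (Chain.chain_of_block Reflect.AtomM8K4QF83.block)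
        (block_reverse Reflect.AtomM8K4QF83.block) (Equiv.refl (Fin 8)) (by intro i; fin_cases i <;> norm_num))
        Reflect.AtomM8K4QF83.block (Equiv.refl (Fin 8)) (by intro i; fin_cases i <;> norm_num))
        (block_reverse Reflect.AtomM8K4QF83.block) (Equiv.refl (Fin 8)) (by intro i; fin_cases i <;> norm_num))
  norm_num at h
  exact h

/-! ### Rows appended 2026-08-29T04:41Z (val-v1x-eng-8 g3): (8,6) ≥ 129 [M8K3LT44 ▹ M8K4QF85] (was 127); (8,7) ≥ 170 [M8K4QF85ʳ ▹ M8K4QF85] (was 166); (8,8) ≥ 180 [M8K4QF85 ▹ M8K5GF95ʳ] (was 178); (8,9) ≥ 214 [M8K3LT44 ▹ M8K4QF85 ▹ M8K4QF85ʳ] (was 210); (8,10) ≥ 255 [M8K4QF85 ▹ M8K4QF85ʳ ▹ M8K4QF85] (was 249); (8,11) ≥ 265 [M8K4QF85 ▹ M8K4QF85ʳ ▹ M8K5GF95] (was 261); (8,12) ≥ 299 [M8K3LT44 ▹ M8K4QF85 ▹ M8K4QF85ʳ ▹ M8K4QF85] (was 293); (8,13) ≥ 340 [M8K4QF85 ▹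 M8K4QF85ʳ ▹ M8K4QF85 ▹ M8K4QF85ʳ] (was 332). -/

/-- **`ζ_sym(8,6) ≥ 129`** (`¬ PosRootLawAt 8 6 128`) — the block word `M8K3LT44 ▹ M8K4QF85` = `44 + 85` alternations on
`3 + 4 − 1` letters (junction law for matching junction inertia; kernel value before this file: 127). LAGTOWER44 ▹ QF85 (val-v1x-eng-7 g3, 04:28Z: one tower root sacrificed instead of two) on the shared (4,4) letter; supersedes mix_8_6 (127): (8,6) ≥ 129 = B+5. [folklore] -/
theorem mix_8_6b : ¬ PosRootLawAt 8 6 128 := by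
  have h := Chain.not_posRootLawAt_of_certificateT (by norm_num)
      (Chain.chain_append (by norm_num) (Chain.chain_of_block Reflect.AtomM8K3LT44.block)
        Reflect.AtomM8K4QF85.block (Equiv.refl (Fin 8)) (by intro i; fin_cases i <;> norm_num))
  norm_num at h
  exact h

/-- **`ζ_sym(8,7) ≥ 170`** (`¬ PosRootLawAt 8 7 169`) — the block word `M8K4QF85ʳ ▹ M8K4QF85` = `85 + 85` alternations on
`4 + 4 − 1` letters (junction law for matching junction inertia; kernel value before this file: 166). supersedes mix_8_7 (166). [folklore] -/
theorem mix_8_7b : ¬ PosRootLawAt 8 7 169 := by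
  have h := Chain.not_posRootLawAt_of_certificateT (by norm_num)
      (Chain.chain_append (by norm_num) (Chain.chain_of_block (block_reverse Reflect.AtomM8K4QF85.block))
        Reflect.AtomM8K4QF85.block (Equiv.refl (Fin 8)) (by intro i; fin_cases i <;> norm_num))
  norm_num at h
  exact h

/-- **`ζ_sym(8,8) ≥ 180`** (`¬ PosRootLawAt 8 8 179`) — the block word `M8K4QF85 ▹ M8K5GF95ʳ` = `85 + 95` alternations on
`4 + 5 − 1` letters (junction law for matching junction inertia; kernel value before this file: 178). QF85 ▹ GAPFLAG95ʳ on the two (3,5) flag letters; supersedes mix_8_8 (178). [folklore] -/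
theorem mix_8_8b : ¬ PosRootLawAt 8 8 179 := by
  have h := Chain.not_posRootLawAt_of_certificateT (by norm_num)
      (Chain.chain_append (by norm_num) (Chain.chain_of_block Reflect.AtomM8K4QF85.block)
        (block_reverse Reflect.AtomM8K5GF95.block) (Equiv.refl (Fin 8)) (by intro i; fin_cases i <;> norm_num))
  norm_num at h
  exact h

/-- **`ζ_sym(8,9) ≥ 214`** (`¬ PosRootLawAt 8 9 213`) — the block word `M8K3LT44 ▹ M8K4QF85 ▹ M8K4QF85ʳ` = `44 + 85 + 85` alternations on
`3 + 4 + 4 − 2` letters (junction law for matching junction inertia; kernel value before this file: 210). [folklore] -/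
theorem mix_8_9b : ¬ PosRootLawAt 8 9 213 := by
  have h := Chain.not_posRootLawAt_of_certificateT (by norm_num)
      (Chain.chain_append (by norm_num) (Chain.chain_append (by norm_num) (Chain.chain_of_block Reflect.AtomM8K3LT44.block)
        Reflect.AtomM8K4QF85.block (Equiv.refl (Fin 8)) (by intro i; fin_cases i <;> norm_num))
        (block_reverse Reflect.AtomM8K4QF85.block) (Equiv.refl (Fin 8)) (by intro i; fin_cases i <;> norm_num))
  norm_num at h
  exact h

/-- **`ζ_sym(8,10) ≥ 255`** (`¬ PosRootLawAt 8 10 254`) — the block word `M8K4QF85 ▹ M8K4QF85ʳ ▹ M8K4QF85` = `85 + 85 + 85` alternations on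
`4 + 4 + 4 − 2` letters (junction law for matching junction inertia; kernel value before this file: 249). [folklore] -/
theorem mix_8_10b : ¬ PosRootLawAt 8 10 254 := by
  have h := Chain.not_posRootLawAt_of_certificateT (by norm_num)
      (Chain.chain_append (by norm_num) (Chain.chain_append (by norm_num) (Chain.chain_of_block Reflect.AtomM8K4QF85.block)
        (block_reverse Reflect.AtomM8K4QF85.block) (Equiv.refl (Fin 8)) (by intro i; fin_cases i <;> norm_num))
        Reflect.AtomM8K4QF85.block (Equiv.refl (Fin 8)) (by intro i; fin_cases i <;> norm_num))
  norm_num at h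
  exact h

/-- **`ζ_sym(8,11) ≥ 265`** (`¬ PosRootLawAt 8 11 264`) — the block word `M8K4QF85 ▹ M8K4QF85ʳ ▹ M8K5GF95` = `85 + 85 + 95` alternations on
`4 + 4 + 5 − 2` letters (junction law for matching junction inertia; kernel value before this file: 261). [folklore] -/
theorem mix_8_11c : ¬ PosRootLawAt 8 11 264 := by
  have h := Chain.not_posRootLawAt_of_certificateT (by norm_num)
      (Chain.chain_append (by norm_num) (Chain.chain_append (by norm_num) (Chain.chain_of_block Reflect.AtomM8K4QF85.block)
        (block_reverse Reflect.AtomM8K4QF85.block) (Equiv.refl (Fin 8)) (by intro i; fin_cases i <;> norm_num))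
        Reflect.AtomM8K5GF95.block (Equiv.refl (Fin 8)) (by intro i; fin_cases i <;> norm_num))
  norm_num at h
  exact h

/-- **`ζ_sym(8,12) ≥ 299`** (`¬ PosRootLawAt 8 12 298`) — the block word `M8K3LT44 ▹ M8K4QF85 ▹ M8K4QF85ʳ ▹ M8K4QF85` = `44 + 85 + 85 + 85` alternations on
`3 + 4 + 4 + 4 − 3` letters (junction law for matching junction inertia; kernel value before this file: 293). [folklore] -/
theorem mix_8_12b : ¬ PosRootLawAt 8 12 298 := by
  have h := Chain.not_posRootLawAt_of_certificateT (by norm_num)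
      (Chain.chain_append (by norm_num) (Chain.chain_append (by norm_num) (Chain.chain_append (by norm_num) (Chain.chain_of_block Reflect.AtomM8K3LT44.block)
        Reflect.AtomM8K4QF85.block (Equiv.refl (Fin 8)) (by intro i; fin_cases i <;> norm_num))
        (block_reverse Reflect.AtomM8K4QF85.block) (Equiv.refl (Fin 8)) (by intro i; fin_cases i <;> norm_num))
        Reflect.AtomM8K4QF85.block (Equiv.refl (Fin 8)) (by intro i; fin_cases i <;> norm_num))
  norm_num at h
  exact h

/-- **`ζ_sym(8,13) ≥ 340`** (`¬ PosRootLawAt 8 13 339`) — the block word `M8K4QF85 ▹ M8K4QF85ʳ ▹ M8K4QF85 ▹ M8K4QF85ʳ` = `85 + 85 + 85 + 85` alternations on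
`4 + 4 + 4 + 4 − 3` letters (junction law for matching junction inertia; kernel value before this file: 332). [folklore] -/
theorem mix_8_13b : ¬ PosRootLawAt 8 13 339 := by
  have h := Chain.not_posRootLawAt_of_certificateT (by norm_num)
      (Chain.chain_append (by norm_num) (Chain.chain_append (by norm_num) (Chain.chain_append (by norm_num) (Chain.chain_of_block Reflect.AtomM8K4QF85.block)
        (block_reverse Reflect.AtomM8K4QF85.block) (Equiv.refl (Fin 8)) (by intro i; fin_cases i <;> norm_num))
        Reflect.AtomM8K4QF85.block (Equiv.refl (Fin 8)) (by intro i; fin_cases i <;> norm_num))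
        (block_reverse Reflect.AtomM8K4QF85.block) (Equiv.refl (Fin 8)) (by intro i; fin_cases i <;> norm_num))
  norm_num at h
  exact h

end Summit.ValiantsHypothesis.ValiantsHypothesis.Theorems.LacunarySymmetroidMatrixDescartes.Census.Reflect.MixM8
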